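import Literature.AlgebraicGeometry.Resolution.H0CubeIdentity
import Literature.AlgebraicGeometry.Resolution.BlowupsProduct
import HarnessLib

/-!
# Lipman 1969, Prop. (13.1) b) in `h⁰`-form for exceptional curves `F`, `G` WITHOUT common component
# (the disjoint-multiset instances of the named fact `Lipman1969_13_1_b_rat`)

Topic: `Literature/AlgebraicGeometry/Resolution`.  PROVED, fact-free, definition-free.  J. Lipman, *Rational
singularities …*, Publ. Math. IHÉS 36 (1969), Prop. (13.1) b) (p. 223): "`(D·(E+F)) = (D·E) + (D·F)`" (with d)
`(F·E) = χ(E) + χ(F) − χ(E+F)`), which the tree renders in `h⁰`-lengths over a rational surface singularity as the named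
fact `Lipman1969_13_1_b_rat` (`Resolution/Lipman1969IntersectionTheory`) for effective exceptional divisors
`E = V(∏_s 𝓘_η)`, `F = V(∏_t 𝓘_η)`, `G = V(∏_u 𝓘_η)`.  This file proves its instances with `F`, `G` WITHOUT COMMON
COMPONENT (`t`, `u` disjoint) on any resolution with `H¹(X, 𝒪_X) = 0` — hence, given Prop. (1.2) 2) (`Lipman1969_1_2`, in
the same print bundle), in the rational regime — by unpacking "products of distinct exceptional primes" into the
hypotheses of the cube identity `Resolution/H0CubeIdentity` (`𝓙 ∩ 𝓚 = 𝓙𝓚`, `V(𝓙+𝓚)` a finite set of closed points,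
`𝓘` invertible):

* §1 `exists_stalkIdeal_prod_primeDivisorIdeal_eq_span` (stalks of `∏ 𝓘_η` are principal with prime factors among the
  `𝔭_η`), **`prod_primeDivisorIdeal_inf_eq_mul`** (`(∏_t 𝓘_η) ∩ (∏_u 𝓘_η) = ∏_t 𝓘_η · ∏_u 𝓘_η` for disjoint `t`, `u`, on a
  locally factorial integral scheme), `coe_support_prod_primeDivisorIdeal`, `isEffectiveCartier_prod_primeDivisorIdeal`;
* §2 `h0_prod_primeDivisorIdeal_ne_top`, **`h0_biadditivity_of_disjoint`** (on a resolution with `H¹(X, 𝒪_X) = 0`),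
  **`Lipman1969_13_1_b_rat_of_disjoint`** (the disjoint instances of the named fact, given `Lipman1969_1_2`).

What is NOT here: `t`, `u` with common points (e.g. `⟨𝓘, 𝓘_E · 𝓘_E⟩ = 2⟨𝓘, 𝓘_E⟩`), which needs the degree of the conormal
sheaves `𝓘_E^i/𝓘_E^{i+1}` on `E` (Riemann–Roch on the exceptional curve), as does the self-intersection case of
`Lipman1969_13_1_d_rat`.

## References
* J. Lipman, Publ. Math. IHÉS 36 (1969), Prop. (13.1) b), d) and proof (p. 223), §10 (p. 212). [Lipman1969]
* U. Görtz, T. Wedhorn, *Algebraic Geometry I* (2nd ed. 2020), Thm. 11.40 (2). [GortzWedhorn2020]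
-/

noncomputable section

open CategoryTheory AlgebraicGeometry TopologicalSpace IsLocalRing
open Literature.AlgebraicGeometry.Morphisms Literature.AlgebraicGeometry.Motives
open Scheme.IdealSheafData

universe u

namespace Literature.AlgebraicGeometry.Resolution

/-! ## §1 Products of prime divisor ideals: stalks, supports, invertibility, intersections -/

section Products

variable {X : Scheme.{u}} [IsIntegral X]

/-- Stalkwise, a product of prime divisor ideals on a locally factorial integral scheme is principal, generated by
a product of prime elements and units: `(∏_{η ∈ t} 𝓘_η)_x = (a)` with every prime factor of `a` associated to the
prime `p_η` of some `η ∈ t` specialising to `x`. [cite: GortzWedhorn2020, Thm. 11.40 (2)] -/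
theorem exists_stalkIdeal_prod_primeDivisorIdeal_eq_span
    (hX : ∀ x : X, UniqueFactorizationMonoid (X.presheaf.stalk x)) (t : Multiset X)
    (ht : ∀ η ∈ t, Order.coheight η = 1) (x : X) :
    ∃ a : X.presheaf.stalk x, stalkIdeal (t.map primeDivisorIdeal).prod x = Ideal.span {a} ∧ a ≠ 0 ∧
      ∀ d : X.presheaf.stalk x, Prime d → d ∣ a →
        ∃ (η : X) (_ : η ∈ t) (h : η ⤳ x), Ideal.span {d} = primeOfSpecializes h := by
  classical
  haveI := hX x
  induction t using Multiset.induction_on with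
  | empty =>
    refine ⟨1, ?_, one_ne_zero, fun d hd hd1 => absurd (isUnit_of_dvd_one hd1) hd.not_unit⟩
    rw [Multiset.map_zero, Multiset.prod_zero]
    change stalkIdeal (⊤ : X.IdealSheafData) x = _
    rw [stalkIdeal_top, Ideal.span_singleton_one]
  | cons η t ih =>
    obtain ⟨a, ha, ha0, hprime⟩ := ih (fun η' hη' => ht η' (Multiset.mem_cons_of_mem hη'))
    have hη : Order.coheight η = 1 := ht η (Multiset.mem_cons_self η t)
    rw [Multiset.map_cons, Multiset.prod_cons, stalkIdeal_mul, ha]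
    by_cases h : η ⤳ x
    · obtain ⟨p, hp, hpeq⟩ := exists_prime_primeOfSpecializes_eq_span h hη
      refine ⟨p * a, ?_, mul_ne_zero hp.ne_zero ha0, fun d hd hdvd => ?_⟩
      · rw [stalkIdeal_primeDivisorIdeal h, hpeq, Ideal.span_singleton_mul_span_singleton]
      · rcases hd.dvd_or_dvd hdvd with h1 | h1
        · refine ⟨η, Multiset.mem_cons_self η t, h, ?_⟩
          rw [hpeq]
          exact Ideal.span_singleton_eq_span_singleton.mpr (hd.irreducible.associated_of_dvd hp.irreducible h1)
        · obtain ⟨η', hη', h', e⟩ := hprime d hd h1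
          exact ⟨η', Multiset.mem_cons_of_mem hη', h', e⟩
    · refine ⟨a, ?_, ha0, fun d hd hdvd => ?_⟩
      · rw [stalkIdeal_primeDivisorIdeal_eq_top h, Ideal.top_mul]
      · obtain ⟨η', hη', h', e⟩ := hprime d hd hdvd
        exact ⟨η', Multiset.mem_cons_of_mem hη', h', e⟩

/-- **Products of prime divisor ideals over DISJOINT sets of curves intersect in their product**:
`(∏_t 𝓘_η) ∩ (∏_u 𝓘_η) = (∏_t 𝓘_η)(∏_u 𝓘_η)` when no point of `t` is a point of `u` (stalkwise the generators have no
common prime factor, and `(a) ∩ (b) = (ab)` for such `a`, `b` in a factorial domain). This identifies Lipman's curve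
`F + G` (ideal `𝒪(−F)𝒪(−G)`) with `F ∪ G` for `F`, `G` without common component. [cite: Lipman1969, Section 13 (p. 223)] -/
theorem prod_primeDivisorIdeal_inf_eq_mul (hX : ∀ x : X, UniqueFactorizationMonoid (X.presheaf.stalk x))
    (t u : Multiset X) (ht : ∀ η ∈ t, Order.coheight η = 1) (hu : ∀ η ∈ u, Order.coheight η = 1)
    (htu : ∀ η ∈ t, η ∉ u) :
    (t.map primeDivisorIdeal).prod ⊓ (u.map primeDivisorIdeal).prod =
      (t.map primeDivisorIdeal).prod * (u.map primeDivisorIdeal).prod := by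
  apply le_antisymm
  · refine le_of_forall_stalkIdeal_le fun x => ?_
    haveI := hX x
    obtain ⟨a, ha, ha0, hpa⟩ := exists_stalkIdeal_prod_primeDivisorIdeal_eq_span hX t ht x
    obtain ⟨b, hb, hb0, hpb⟩ := exists_stalkIdeal_prod_primeDivisorIdeal_eq_span hX u hu x
    rw [stalkIdeal_inf, stalkIdeal_mul, ha, hb, Ideal.span_singleton_mul_span_singleton]
    rintro z ⟨hza, hzb⟩
    rw [SetLike.mem_coe, Ideal.mem_span_singleton] at hza hzb
    rw [Ideal.mem_span_singleton]
    obtain ⟨y, rfl⟩ := hza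
    -- `b ∣ a y` with `a`, `b` without common prime factor, so `b ∣ y`
    have hno : ∀ ⦃d⦄, d ∣ b → d ∣ a → ¬Prime d := by
      intro d hdb hda hd
      obtain ⟨η, hη, h, e⟩ := hpa d hd hda
      obtain ⟨η', hη', h', e'⟩ := hpb d hd hdb
      have : η = η' := primeOfSpecializes_injective h h' (e.symm.trans e')
      exact htu η hη (this ▸ hη')
    have hby : b ∣ y :=
      UniqueFactorizationMonoid.dvd_of_dvd_mul_right_of_no_prime_factors hb0 (fun {d} hdb hda => hno hdb hda) hzb
    exact mul_dvd_mul_left a hby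
  · intro U
    rw [ideal_inf, ideal_mul, Pi.inf_apply, Pi.mul_apply]
    exact Ideal.mul_le_inf

omit [IsIntegral X] in
/-- The support of a product of prime divisor ideals is the union of the curves (Lipman's `E + F` has support
`E ∪ F`). [cite: Lipman1969, Section 13 (p. 223)] -/
theorem coe_support_prod_primeDivisorIdeal (t : Multiset X) :
    (((t.map primeDivisorIdeal).prod).support : Set X) = ⋃ η ∈ t, closure {η} := by
  classical
  induction t using Multiset.induction_on with
  | empty =>
    rw [Multiset.map_zero, Multiset.prod_zero]
    change ((⊤ : X.IdealSheafData).support : Set X) = _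
    simp
  | cons η t ih =>
    rw [Multiset.map_cons, Multiset.prod_cons, support_mul]
    change ((primeDivisorIdeal η).support : Set X) ∪ (((t.map primeDivisorIdeal).prod).support : Set X) = _
    rw [coe_support_primeDivisorIdeal, ih]
    ext x
    simp [Multiset.mem_cons]

/-- A product of prime divisor ideals on a regular integral locally Noetherian scheme is an effective Cartier divisor.
[cite: GortzWedhorn2020, Thm. 11.40 (2)] -/
theorem isEffectiveCartier_prod_primeDivisorIdeal [IsLocallyNoetherian X] (hX : Scheme.IsRegular X)
    (t : Multiset X) (ht : ∀ η ∈ t, Order.coheight η = 1) :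
    IsEffectiveCartier (t.map primeDivisorIdeal).prod := by
  classical
  induction t using Multiset.induction_on with
  | empty =>
    rw [Multiset.map_zero, Multiset.prod_zero]
    exact isEffectiveCartier_top
  | cons η t ih =>
    rw [Multiset.map_cons, Multiset.prod_cons]
    exact (isEffectiveCartier_primeDivisorIdeal_of_isRegular hX (ht η (Multiset.mem_cons_self η t))).mul
      (ih fun η' hη' => ht η' (Multiset.mem_cons_of_mem hη'))

end Products

/-! ## §2 (13.1) b) in `h⁰`-form for `F`, `G` without common component -/

section Main

variable {T : Type u} [CommRing T] [IsNoetherianRing T] [IsLocalRing T] [IsDomain T]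
  {X : Scheme.{u}} [IsIntegral X] [IsLocallyNoetherian X] {π : X ⟶ Spec (.of T)}

omit [IsDomain T] [IsIntegral X] [IsLocallyNoetherian X] in
/-- `h⁰(𝒪_X/∏_{η∈t} 𝓘_η)` is finite for exceptional curves `η ∈ excCurvePoints π` (the subscheme lies over the closed
point). [cite: Lipman1969, Section 10 (p. 212)] -/
theorem h0_prod_primeDivisorIdeal_ne_top [IsProper π] (t : Multiset X) (ht : ∀ η ∈ t, η ∈ excCurvePoints π) :
    h0 π (t.map primeDivisorIdeal).prod ≠ ⊤ := by
  refine h0_ne_top_of_base_eq_closedPoint π _ fun x => ?_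
  have hx : (t.map primeDivisorIdeal).prod.subschemeι.base x ∈ (((t.map primeDivisorIdeal).prod).support : Set X) :=
    (Set.ext_iff.mp (Scheme.IdealSheafData.range_subschemeι (I := (t.map primeDivisorIdeal).prod)) _).mp
      (Set.mem_range_self x)
  rw [coe_support_prod_primeDivisorIdeal] at hx
  obtain ⟨η, hη, hxη⟩ := Set.mem_iUnion₂.mp hx
  exact base_eq_closedPoint_of_specializes π (ht η hη).1 (specializes_iff_mem_closure.2 hxη)

/-- **Lipman 1969, Prop. (13.1) b) (with d)) in `h⁰`-lengths for curves without common component**: on a resolution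
`π : X → Spec T` of a two-dimensional Noetherian local domain with `H¹(X, 𝒪_X) = 0`, for effective exceptional divisors
`E = V(𝓘)`, `F = V(𝓙)`, `G = V(𝓚)` given by products of prime ideals of integral exceptional curves with `F` and `G`
WITHOUT COMMON COMPONENT (the multisets `t`, `u` disjoint), `(E·(F+G)) = (E·F) + (E·G)` for
`(A·B) := h⁰(𝒪/𝓐) + h⁰(𝒪/𝓑) − h⁰(𝒪/𝓐𝓑)`, i.e.
`h0 𝓘 + h0 (𝓙𝓚) − h0 (𝓘𝓙𝓚) = (h0 𝓘 + h0 𝓙 − h0 (𝓘𝓙)) + (h0 𝓘 + h0 𝓚 − h0 (𝓘𝓚))` (`ENat.toNat` casts to `ℤ`, all finite).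
The case of common components (`Lipman1969_13_1_b_rat` in full) needs the degree of the conormal sheaves and is NOT
covered. [cite: Lipman1969, Proposition (13.1) b) and d) (p. 223)] -/
theorem h0_biadditivity_of_disjoint (h2 : ringKrullDim T = 2) (hπ : IsResolution π) (h1 : HasTrivialCechH1 π)
    (s t u : Multiset X) (hs : ∀ η ∈ s, η ∈ excCurvePoints π) (ht : ∀ η ∈ t, η ∈ excCurvePoints π)
    (hu : ∀ η ∈ u, η ∈ excCurvePoints π) (htu : ∀ η ∈ t, η ∉ u) :
    let 𝓘 : X.IdealSheafData := (s.map primeDivisorIdeal).prod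
    let 𝓙 : X.IdealSheafData := (t.map primeDivisorIdeal).prod
    let 𝓚 : X.IdealSheafData := (u.map primeDivisorIdeal).prod
    ((h0 π 𝓘).toNat : ℤ) + ((h0 π (𝓙 * 𝓚)).toNat : ℤ) - ((h0 π (𝓘 * 𝓙 * 𝓚)).toNat : ℤ) =
      (((h0 π 𝓘).toNat : ℤ) + ((h0 π 𝓙).toNat : ℤ) - ((h0 π (𝓘 * 𝓙)).toNat : ℤ)) +
        (((h0 π 𝓘).toNat : ℤ) + ((h0 π 𝓚).toNat : ℤ) - ((h0 π (𝓘 * 𝓚)).toNat : ℤ)) := by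
  intro 𝓘 𝓙 𝓚
  classical
  haveI : IsProper π := hπ.isProper
  haveI : IsNoetherian X := by
    haveI : CompactSpace X := QuasiCompact.compactSpace_of_compactSpace π
    exact {}
  have hX : Scheme.IsRegular X := hπ.isRegular
  have hco : ∀ η ∈ excCurvePoints π, Order.coheight η = 1 := fun η hη => hπ.coheight_eq_one_of_mem_excCurvePoints h2 hη
  -- the hypotheses of the cube identity
  have hI : IsEffectiveCartier 𝓘 := isEffectiveCartier_prod_primeDivisorIdeal hX s fun η hη => hco η (hs η hη)
  have hJK : 𝓙 ⊓ 𝓚 = 𝓙 * 𝓚 := prod_primeDivisorIdeal_inf_eq_mul hX.uniqueFactorizationMonoid_stalk t u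
    (fun η hη => hco η (ht η hη)) (fun η hη => hco η (hu η hη)) htu
  set Z : Set X := ⋃ η ∈ t, ⋃ η' ∈ u, closure ({η} : Set X) ∩ closure {η'} with hZdef
  have hZ : Z.Finite := by
    refine Set.Finite.biUnion (Multiset.finite_toSet t) fun η hη => ?_
    refine Set.Finite.biUnion (Multiset.finite_toSet u) fun η' hη' => ?_
    have hne : η ≠ η' := fun e => htu η hη (e ▸ hη')
    exact finite_closure_inter_closure_of_height_le_one (ht η hη).2.le (hu η' hη').2.le hne
  have hZcl : ∀ p ∈ Z, IsClosed ({p} : Set X) := by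
    intro p hp
    obtain ⟨η, hη, hp⟩ := Set.mem_iUnion₂.mp hp
    obtain ⟨η', hη', hp⟩ := Set.mem_iUnion₂.mp hp
    have hne : η ≠ η' := fun e => htu η hη (e ▸ hη')
    exact isClosed_singleton_of_mem_closure_inter (ht η hη).2.le (hu η' hη').2.le hne hp
  have hsupp : ((𝓙 ⊔ 𝓚).support : Set X) ⊆ Z := by
    intro x hx
    have hJ : x ∈ (𝓙.support : Set X) := support_antitone (le_sup_left : 𝓙 ≤ 𝓙 ⊔ 𝓚) hx
    have hK : x ∈ (𝓚.support : Set X) := support_antitone (le_sup_right : 𝓚 ≤ 𝓙 ⊔ 𝓚) hx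
    rw [coe_support_prod_primeDivisorIdeal] at hJ hK
    obtain ⟨η, hη, hxη⟩ := Set.mem_iUnion₂.mp hJ
    obtain ⟨η', hη', hxη'⟩ := Set.mem_iUnion₂.mp hK
    exact Set.mem_iUnion₂.mpr ⟨η, hη, Set.mem_iUnion₂.mpr ⟨η', hη', hxη, hxη'⟩⟩
  have hcube := hπ.h0_cube_identity π h2 h1 𝓘 𝓙 𝓚 hI hJK hZ hZcl hsupp
  -- finiteness of all the lengths
  have hprod : ∀ a b : Multiset X, ((a.map primeDivisorIdeal).prod * (b.map primeDivisorIdeal).prod : X.IdealSheafData) =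
      ((a + b).map primeDivisorIdeal).prod := fun a b => by rw [Multiset.map_add, Multiset.prod_add]
  have fI : h0 π 𝓘 ≠ ⊤ := h0_prod_primeDivisorIdeal_ne_top (π := π) s hs
  have fJ : h0 π 𝓙 ≠ ⊤ := h0_prod_primeDivisorIdeal_ne_top (π := π) t ht
  have fK : h0 π 𝓚 ≠ ⊤ := h0_prod_primeDivisorIdeal_ne_top (π := π) u hu
  have fJK : h0 π (𝓙 * 𝓚) ≠ ⊤ := by
    change h0 π ((t.map primeDivisorIdeal).prod * (u.map primeDivisorIdeal).prod) ≠ ⊤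
    rw [hprod]
    exact h0_prod_primeDivisorIdeal_ne_top _ fun η hη => (Multiset.mem_add.mp hη).elim (ht η) (hu η)
  have fIJ : h0 π (𝓘 * 𝓙) ≠ ⊤ := by
    change h0 π ((s.map primeDivisorIdeal).prod * (t.map primeDivisorIdeal).prod) ≠ ⊤
    rw [hprod]
    exact h0_prod_primeDivisorIdeal_ne_top _ fun η hη => (Multiset.mem_add.mp hη).elim (hs η) (ht η)
  have fIK : h0 π (𝓘 * 𝓚) ≠ ⊤ := by
    change h0 π ((s.map primeDivisorIdeal).prod * (u.map primeDivisorIdeal).prod) ≠ ⊤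
    rw [hprod]
    exact h0_prod_primeDivisorIdeal_ne_top _ fun η hη => (Multiset.mem_add.mp hη).elim (hs η) (hu η)
  have fIJK : h0 π (𝓘 * 𝓙 * 𝓚) ≠ ⊤ := by
    change h0 π ((s.map primeDivisorIdeal).prod * (t.map primeDivisorIdeal).prod * (u.map primeDivisorIdeal).prod) ≠ ⊤
    rw [hprod, hprod]
    exact h0_prod_primeDivisorIdeal_ne_top _ fun η hη => (Multiset.mem_add.mp hη).elim
      (fun h => (Multiset.mem_add.mp h).elim (hs η) (ht η)) (hu η)
  -- pass to natural numbers
  have key : (h0 π (𝓙 * 𝓚)).toNat + (h0 π (𝓘 * 𝓙)).toNat + (h0 π (𝓘 * 𝓚)).toNat =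
      (h0 π 𝓘).toNat + (h0 π 𝓙).toNat + (h0 π 𝓚).toNat + (h0 π (𝓘 * 𝓙 * 𝓚)).toNat := by
    apply Nat.cast_injective (R := ℕ∞)
    simp only [Nat.cast_add, ENat.coe_toNat fJK, ENat.coe_toNat fIJ, ENat.coe_toNat fIK, ENat.coe_toNat fI,
      ENat.coe_toNat fJ, ENat.coe_toNat fK, ENat.coe_toNat fIJK]
    exact hcube
  omega

/-- **The disjoint instances of the named fact `Lipman1969_13_1_b_rat`** (rational regime: `S` normal of dimension
`2` with a rational singularity, `π` any desingularization), for `t`, `u` without common point, GIVEN Prop. (1.2) 2)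
(`Lipman1969_1_2`, hypothesis `h12`, in the W3 bundle). [cite: Lipman1969, Proposition (13.1) b) and d) (p. 223)] -/
theorem Lipman1969_13_1_b_rat_of_disjoint (h12 : Lipman1969_1_2.{u})
    {S : Type u} [CommRing S] [IsNoetherianRing S] [IsLocalRing S] [IsDomain S] [IsIntegrallyClosed S]
    (hdim : ringKrullDim S = 2) (hrat : HasRationalSingularity S)
    {X : Scheme.{u}} (π : X ⟶ Spec (.of S)) (hπ : IsResolution π)
    (s t u : Multiset X) (hs : ∀ η ∈ s, η ∈ excCurvePoints π) (ht : ∀ η ∈ t, η ∈ excCurvePoints π)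
    (hu : ∀ η ∈ u, η ∈ excCurvePoints π) (htu : ∀ η ∈ t, η ∉ u) :
    let 𝓘 : X.IdealSheafData := (s.map primeDivisorIdeal).prod
    let 𝓙 : X.IdealSheafData := (t.map primeDivisorIdeal).prod
    let 𝓚 : X.IdealSheafData := (u.map primeDivisorIdeal).prod
    ((h0 π 𝓘).toNat : ℤ) + ((h0 π (𝓙 * 𝓚)).toNat : ℤ) - ((h0 π (𝓘 * 𝓙 * 𝓚)).toNat : ℤ) =
      (((h0 π 𝓘).toNat : ℤ) + ((h0 π 𝓙).toNat : ℤ) - ((h0 π (𝓘 * 𝓙)).toNat : ℤ)) +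
        (((h0 π 𝓘).toNat : ℤ) + ((h0 π 𝓚).toNat : ℤ) - ((h0 π (𝓘 * 𝓚)).toNat : ℤ)) := by
  haveI : IsIntegral X := hπ.isIntegral_source
  haveI : IsProper π := hπ.isProper
  haveI : IsLocallyNoetherian X := LocallyOfFiniteType.isLocallyNoetherian π
  exact h0_biadditivity_of_disjoint hdim hπ (h12.hasTrivialCechH1_of_isResolution hdim hrat π hπ) s t u hs ht hu htu

end Main

end Literature.AlgebraicGeometry.Resolution

end
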